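import Summits.QuantumFields.BalabanUV.T4Continuum.Support.ShellMeasurePinnedNorm
import Summits.QuantumFields.BalabanUV.T4Continuum.Support.NE9KernelGeometryTorus

/-!
# `T4Continuum.ShellMeasurePinnedNormEta` — η-BOOKKEEPING OF THE PINNED ENGINE: the owner's NOTE N-ne7cp1-g31-3
# «η⁴ IN THE PINNED KERNEL CONSTANTS» made a KERNEL statement — S69's pinned operator bound and located sums, read on
# the FINE torus with the cell volume `η^d` in the kernel ∕ per-index cost, decay in PHYSICAL distance `η·|·|₁`, and an
# η-FREE-sized reference set, have η-FREE constants `c₀·m·(2(d + a)∕a)^d`; the naive reading is `∝ η^{−d}`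
(cell `pub-balaban`, sub-cell `t4`, spine estimate NE7c (node U5b); NE7c ROUND-2 crew, unit
`b2b-balaban-t4-ne7c-formalise-leaf-01` gen 7 (S70 holder lineage), own-initiative junction OFFERED on the journal
(CLAIMS.log l.17323) against the owner's NOTE N-ne7cp1-g31-3 (l.17095); ADDITIVE — imports S69 `ShellMeasurePinnedNorm`
(p223286: `pinW`, `kerOpPin`, `opNorm_kerOpPin_le`, `pinDist`, `pinDist_le_add`, `sum_exp_neg_pinDist_le`; hence S66 f3a
`ShellMeasureDecayKernelSums.sum_exp_pl1_comp_le` and print's cube-sum constant `B12Decay510Window.K₁`) and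
`NE9KernelGeometryTorus` (ne9 crew, p215818 — `K₁_le_c0`, the closed form `K₁ d δ ≤ (2∕(1 − e^{−δ∕d}))^d`) ONLY; [folklore];
0 `def`, 0 `def … : Prop`, 0 sorry, 0 citations)

HONEST FRAMING.  Finite four-torus programme, rung (B)+1 only — NOT infinite volume, NOT a mass gap, NOT the Clay
problem, NOT summit progress; (B), `BetaPertHyp`, (B^μ) not consumed.  NE7c (`T4IndicatorShell.ShellWeightBound`) is NOT
PRINTED in [Balaban 1983–89] and NOT PROVED; «NE7c ⇐ the named binders» (trigger c3).  Nothing printed is asserted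
here; no estimate of Bałaban's is discharged: the decay of the kernels of `H`, `H₁` ([Balaban1985BackgroundPropagators]
(3.133)), `𝔊` (Thm 3.3 ∕ 3.13), `𝔇` ([Balaban1985Variational] (73)), `δU_k∕δV` ((190)) and the η-scalings of the read-out
data stay DISPLAYED (locators only, not citations).  This file is ARITHMETIC on exponential lattice sums.
HONEST DEPENDENCY (cell): continuum YM on T⁴ ⇐ BetaPertH ∧ nine spine estimates (0/9 proved); BetaPertH ⇐ (D1) ∧ (D4) ∧
CAP+tail; G-an2-4 gates asym, D1 and NE2/3/4.

THE POINT (owner NOTE N-ne7cp1-g31-3, journal l.17095, the guard-rail for every instantiation of S69 (A)∕(C), S70 f1,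
S71 §3, S74 (W6)∕f2).  Bałaban's propagator ∕ minimiser kernels at a live level `j` are integral kernels against the
η-lattice sum, `(Gf)(x) = Σ_y η^d G(x,y) f(y)`, with a DENSITY bound `|G(x,y)| ≤ c₀e^{−δ₀|x−y|}` in UNIT-lattice
(physical) distance.  Read as a matrix over the FINE sites, the entry bound is `c₀·η^d·e^{−δ₀·η·|x−y|_fine}`: the
cell volume `η^d` sits in the entry, the rate PER FINE STEP is `δ₀η`.  S69's engine is η-blind: (A) `opNorm_kerOpPin_le`
returns `c₀′·M` with `M ≥ Σ_b e^{−(δ−δ′)ρ(x,b)}`, and on the fine torus `M = m·K₁ d ((δ₀−δ′)η) ∼ m·(2d∕((δ₀−δ′)η))^d ∝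
η^{−d}`; (C) `sum_exp_neg_pinDist_le` returns `#B₀·m·K₁ d δ′`, where BOTH factors are `∝ η^{−d}` if the reference set
`B₀` is the block's FINE sites and `δ′` a rate per fine step — against ONE `η^d` in the per-index cost (the square
terms' `|β|H_pO_p ∝ βη⁴`, S72 `squareBudget_le`).  ONLY THE RIGHT PAIRING IS η-FREE, and this file proves it once:
* §1 **`eta_pow_mul_K₁_le`**: `0 < η ≤ 1`, `0 < a`, `1 ≤ d` ⟹ `η^d·K₁ d (a·η) ≤ (2(d + a)∕a)^d` — the cell volume
  cancels the fine row sum (`K₁_le_c0` + `t∕(1+t) ≤ 1 − e^{−t}`); first `K₁_le_of_pos : K₁ d a ≤ (2(d + a)∕a)^d`.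
* §2 **(A-η) `opNorm_kerOpPin_eta_le`**: S69 (A) on the fine torus `(ℤ∕Tℤ)^d` with `ρ x y := η·pl1(x − y)`, the pin
  `ϖ := η·pinDist B₀` (PHYSICAL distance to a reference set; one-sided Lipschitz, `eta_pinDist_le_add`), kernel entries
  `‖k c b‖ ≤ c₀·η^d·e^{−δ·η·pl1(posOut c − posIn b)}`, `0 ≤ δ′ < δ`, `≤ m` input indices per fine site ⟹
  `‖kerOpPin k δ′ (ϖ∘posIn) (ϖ∘posOut)‖ ≤ c₀·m·(2(d + (δ−δ′))∕(δ−δ′))^d` — NO `η`, NO `T`, NO `#B₀`; the FINE-RATE spelling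
  `opNorm_kerOpPin_fineRate_le` (pins `pinDist B₀∘pos` at rate `δ′η`, kernel rate `δη` per fine step — the spelling of
  S70 f1 ∕ S71 ∕ S74 f2's `pinW δ′ (pinDist B₀ ∘ pos)`; `pinW_eta_eq`) has the SAME η-free right-hand side.
* §3 **(C-η) `sum_eta_exp_neg_pinDist_le`** (+ `_fineRate_le`): `Σ_p η^d·e^{−δ′·η·pinDist B₀ (pos p)} ≤ #B₀·m·(2(d + δ′)∕δ′)^d` for ANY finite
  reference set `B₀` — η-free exactly when `#B₀` is (the block's UNIT-lattice sites: `#B₀ ≤ ((L+8)M₂R_j)^4`-TYPE, the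
  same block-geometry count as END-II's `m₀`), and the budget form **`sum_mul_le_of_pinned_eta`** (per-index costs
  `L p ≤ ℓ₀·η^d·e^{−δ′ηϖ}` against sizes `≤ ḡ` ⟹ `Σ_p L p·g p ≤ ℓ₀·ḡ·#B₀·m·(2(d+δ′)∕δ′)^d`) — the η-free inhabitant of
  S74 f2's `Σ_p e_p ≤ K` ∕ S71 §3b's ∕ S69 §5's located-sum binder `K`.
* §4 **THE DISEASE, WITNESSED** (`pl1_le_half`, `naive_doubleSum_ge`): with the reference set = ALL fine sites (here the
  whole fine torus `(ℤ∕Nℤ)^d`, `η = 1∕N`) the double sum that `exp_neg_pinDist_le_sum` trades the pin for obeys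
  `η^d·Σ_{x₀}Σ_x e^{−a·η·pl1(x − x₀)} ≥ N^d·e^{−ad∕2}` — UNBOUNDED in `N = η^{−1}`: the step «min over `B₀` ≤ sum over
  `B₀`» costs exactly `#B₀`, so `B₀` must be η-free-sized.  (A statement about OUR bound under a naive instantiation,
  not about any filed module: S69∕S70∕S71∕S74 f2 keep `B₀`, `δ′`, `c₀` abstract.)
NOT HERE: which reference set and which `c₀`, `δ₀` Bałaban's kernels supply (W-a∕W-h, displayed); the instantiation of
S74 f2 ∕ S71 §3b with §3 (their holders', by name).  NOTHING in the countdown moves; NE7c NOT PROVED; spine PROVED 0∕9.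
-/

noncomputable section

open Metric Set Function

namespace Summit.QuantumFields.BalabanUV.T4Continuum.ShellMeasurePinnedNormEta

open Literature.MathematicalPhysics.QuantumFieldTheory.Balaban1983to89
open Summit.QuantumFields.BalabanUV.T4Continuum.ShellMeasureMultiGridNorms (WSup)
open Summit.QuantumFields.BalabanUV.T4Continuum.ShellMeasureDecayKernelSums (sum_exp_pl1_comp_le)
open Summit.QuantumFields.BalabanUV.T4Continuum.ShellMeasurePinnedNorm
  (pinW kerOpPin opNorm_kerOpPin_le pinDist pinDist_nonneg pinDist_le_add sum_exp_neg_pinDist_le)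
open Summit.QuantumFields.BalabanUV.T4Continuum.NE9KernelGeometryTorus (K₁_le_c0)
open TreeLengthTorus (TPt)
open B12Decay510Torus (pl1 pl1_nonneg pl1_eq_sum pabs pabs_nonneg pabs_zero pabs_eq_natAbs)
open B12Decay510Window (K₁ K₁_nonneg)

/-! ## §1 The cell volume cancels the fine row sum: `η^d·K₁ d (aη) ≤ (2(d+a)∕a)^d` -/

/-- **print's cube-sum constant, a rate-explicit bound**: `K₁ d a ≤ (2(d + a)∕a)^d` for `d ≥ 1`, `a > 0`
(`NE9KernelGeometryTorus.K₁_le_c0` + the elementary `t∕(1+t) ≤ 1 − e^{−t}` at `t = a∕d` — the latter is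
`Literature.Analysis.Complex.div_one_add_le_one_sub_exp_neg` in the tree; re-derived in two lines here rather than
importing the slit-half-strip module into the BalabanUV closure). [folklore] -/
theorem K₁_le_of_pos {d : ℕ} (hd : 0 < d) {a : ℝ} (ha : 0 < a) : K₁ d a ≤ (2 * (d + a) / a) ^ d := by
  have hd' : (0 : ℝ) < d := by exact_mod_cast hd
  have ht : 0 < a / d := div_pos ha hd'
  have h1 : a / d / (1 + a / d) ≤ 1 - Real.exp (-(a / d)) := by
    have hle : Real.exp (-(a / d)) ≤ 1 / (1 + a / d) := by
      rw [Real.exp_neg, one_div]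
      exact inv_anti₀ (by linarith) (by linarith [Real.add_one_le_exp (a / d)])
    have e : a / d / (1 + a / d) = 1 - 1 / (1 + a / d) := by field_simp; ring
    rw [e]
    linarith
  have hpos : 0 < a / d / (1 + a / d) := by positivity
  have h2 : 2 / (1 - Real.exp (-(a / d))) ≤ 2 / (a / d / (1 + a / d)) :=
    div_le_div_of_nonneg_left (by norm_num) hpos h1
  have h3 : 2 / (a / d / (1 + a / d)) = 2 * (d + a) / a := by
    field_simp
  refine (K₁_le_c0 hd ha).trans ?_
  rw [← h3]
  exact pow_le_pow_left₀ (by have := (Real.exp_lt_one_iff.2 (by linarith : -(a / d) < 0)); positivity) h2 d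

/-- **THE CELL VOLUME CANCELS THE FINE ROW SUM**: for `0 < η ≤ 1`, `a > 0`, `d ≥ 1`,
`η^d · K₁ d (a·η) ≤ (2(d + a)∕a)^d` — the `η^d` of the η-lattice measure against the `η^{−d}` of the exponential sum at
the fine rate `aη` (N-ne7cp1-g31-3: «ONLY THE PRODUCT `c₀·M` is η-free»). [folklore] -/
theorem eta_pow_mul_K₁_le {d : ℕ} (hd : 0 < d) {a η : ℝ} (ha : 0 < a) (hη : 0 < η) (hη1 : η ≤ 1) :
    η ^ d * K₁ d (a * η) ≤ (2 * (d + a) / a) ^ d := by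
  have haη : 0 < a * η := mul_pos ha hη
  have h1 : η ^ d * K₁ d (a * η) ≤ η ^ d * (2 * (d + a * η) / (a * η)) ^ d :=
    mul_le_mul_of_nonneg_left (K₁_le_of_pos hd haη) (by positivity)
  have h2 : η ^ d * (2 * (d + a * η) / (a * η)) ^ d = (2 * (d + a * η) / a) ^ d := by
    rw [← mul_pow]
    congr 1
    field_simp
  have h3 : 2 * (d + a * η) / a ≤ 2 * (d + a) / a := by
    refine div_le_div_of_nonneg_right ?_ ha.le
    nlinarith
  refine h1.trans ?_
  rw [h2]
  exact pow_le_pow_left₀ (by positivity) h3 d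

/-! ## §2 (A-η): the pinned operator bound for an η-lattice kernel is η-free -/

section Kernel

variable {Λ Λ' : Type*} [Fintype Λ] [Fintype Λ'] {𝔄 𝔅 : Type*} [NormedAddCommGroup 𝔄] [NormedSpace ℂ 𝔄]
  [NormedAddCommGroup 𝔅] [NormedSpace ℂ 𝔅]
variable {d T : ℕ} [NeZero T]

omit [NeZero T] in
/-- The PHYSICAL pin `η·pinDist B₀` is one-sided Lipschitz for the PHYSICAL periodic ℓ¹ distance `η·pl1(x − y)`
(S69 `pinDist_le_add` scaled by `η ≥ 0`) — the hypothesis `hϖ` of S69 (A). [folklore] -/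
theorem eta_pinDist_le_add [NeZero T] (B₀ : Finset (TPt d T)) (hB₀ : B₀.Nonempty) {η : ℝ} (hη : 0 ≤ η)
    (x y : TPt d T) : η * pinDist B₀ hB₀ x ≤ η * pinDist B₀ hB₀ y + η * pl1 (x - y) := by
  rw [← mul_add]
  exact mul_le_mul_of_nonneg_left (pinDist_le_add B₀ hB₀ x y) hη

omit [Fintype Λ'] in
/-- **THE FINE ROW SUM AT A PHYSICAL RATE, WEIGHTED BY THE CELL VOLUME, IS η-FREE**: for `pos : Λ → (ℤ∕Tℤ)^d` with at
most `m` indices per fine site, `a > 0`, `0 < η ≤ 1`, `d ≥ 1`: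
`η^d · Σ_b e^{−a·η·pl1(x − pos b)} ≤ m·(2(d + a)∕a)^d` for every fine site `x` (S66 f3a `sum_exp_pl1_comp_le` at the
fine rate `aη`, then §1). [folklore] -/
theorem eta_pow_mul_rowSum_le (pos : Λ → TPt d T) {m : ℕ}
    (hm : ∀ x, (Finset.univ.filter fun b => pos b = x).card ≤ m) (hd : 0 < d) {a η : ℝ} (ha : 0 < a)
    (hη : 0 < η) (hη1 : η ≤ 1) (x : TPt d T) :
    η ^ d * ∑ b, Real.exp (-(a * (η * pl1 (x - pos b)))) ≤ m * (2 * (d + a) / a) ^ d := by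
  have hs : ∑ b, Real.exp (-(a * (η * pl1 (x - pos b)))) ≤ m * K₁ d (a * η) := by
    have h := sum_exp_pl1_comp_le pos hm (mul_pos ha hη) x
    simpa only [mul_assoc] using h
  calc η ^ d * ∑ b, Real.exp (-(a * (η * pl1 (x - pos b))))
      ≤ η ^ d * (m * K₁ d (a * η)) := mul_le_mul_of_nonneg_left hs (by positivity)
    _ = m * (η ^ d * K₁ d (a * η)) := by ring
    _ ≤ m * (2 * (d + a) / a) ^ d := mul_le_mul_of_nonneg_left (eta_pow_mul_K₁_le hd ha hη hη1) (Nat.cast_nonneg m)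

/-- **(A-η) DECAYING η-LATTICE KERNEL ⇒ η-FREE PINNED OPERATOR BOUND.**  Indices placed on the fine torus
`(ℤ∕Tℤ)^d` by `posIn`∕`posOut` (at most `m` input indices per fine site), kernel entries bounded by the DENSITY constant
times the CELL VOLUME with decay in PHYSICAL distance, `‖k c b‖ ≤ c₀·η^d·e^{−δ·η·pl1(posOut c − posIn b)}`
([Balaban1985BackgroundPropagators] (3.133)∕Thm 3.3, [Balaban1985Variational] (73)∕(190) TYPE — locators, displayed, not
asserted), the PHYSICAL pin `ϖ = η·pinDist B₀` to ANY nonempty reference set, `0 ≤ δ′ < δ`, `0 < η ≤ 1`, `d ≥ 1` ⟹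
S69's pinned operator `kerOpPin k δ′ (ϖ∘posIn) (ϖ∘posOut)` has norm `≤ c₀·m·(2(d + (δ−δ′))∕(δ−δ′))^d` — NO `η`, NO `T`,
NO `#B₀` (S69 (A) `opNorm_kerOpPin_le` with `ρ := η·pl1`, `M := m·K₁ d ((δ−δ′)η)`, then §1). [folklore] -/
theorem opNorm_kerOpPin_eta_le (k : Λ' → Λ → (𝔄 →L[ℂ] 𝔅)) (posIn : Λ → TPt d T) (posOut : Λ' → TPt d T)
    (B₀ : Finset (TPt d T)) (hB₀ : B₀.Nonempty) {m : ℕ}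
    (hm : ∀ x, (Finset.univ.filter fun b => posIn b = x).card ≤ m) (hd : 0 < d)
    {c₀ δ δ' η : ℝ} (hc₀ : 0 ≤ c₀) (hδ' : 0 ≤ δ') (hδ : δ' < δ) (hη : 0 < η) (hη1 : η ≤ 1)
    (hk : ∀ c b, ‖k c b‖ ≤ c₀ * η ^ d * Real.exp (-(δ * (η * pl1 (posOut c - posIn b))))) :
    ‖kerOpPin k δ' ((fun x => η * pinDist B₀ hB₀ x) ∘ posIn) ((fun x => η * pinDist B₀ hB₀ x) ∘ posOut)‖ ≤
      c₀ * (m * (2 * (d + (δ - δ')) / (δ - δ')) ^ d) := by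
  have hrate : 0 < δ - δ' := by linarith
  -- the reduced-rate fine row sum `M := m·K₁ d ((δ−δ′)η)`
  have hM : ∀ x : TPt d T, ∑ b, Real.exp (-((δ - δ') * (η * pl1 (x - posIn b)))) ≤ m * K₁ d ((δ - δ') * η) :=
    fun x => by
      have h := sum_exp_pl1_comp_le posIn hm (mul_pos hrate hη) x
      simpa only [mul_assoc] using h
  have hM0 : 0 ≤ (m : ℝ) * K₁ d ((δ - δ') * η) := mul_nonneg (Nat.cast_nonneg m) (K₁_nonneg _ _)
  have hop := opNorm_kerOpPin_le k (fun x y => η * pl1 (x - y)) posIn posOut (fun x => η * pinDist B₀ hB₀ x)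
    (c₀ := c₀ * η ^ d) (δ := δ) (δ' := δ') (by positivity) hδ' hM0 (fun c b => hk c b)
    (fun x y => eta_pinDist_le_add B₀ hB₀ hη.le x y) hM
  refine hop.trans ?_
  calc c₀ * η ^ d * (m * K₁ d ((δ - δ') * η)) = c₀ * (m * (η ^ d * K₁ d ((δ - δ') * η))) := by ring
    _ ≤ c₀ * (m * (2 * (d + (δ - δ')) / (δ - δ')) ^ d) :=
        mul_le_mul_of_nonneg_left (mul_le_mul_of_nonneg_left (eta_pow_mul_K₁_le hd hrate hη hη1)
          (Nat.cast_nonneg m)) hc₀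

/-- **(A-η), FINE-RATE SPELLING** — the same bound for consumers whose pins and rates are written PER FINE STEP
(`pinW (δ′η) (pinDist B₀ ∘ pos)`, kernel rate `δη`): `‖k c b‖ ≤ c₀·η^d·e^{−(δη)·pl1(posOut c − posIn b)}`, `0 ≤ δ′ < δ`,
`0 < η ≤ 1` ⟹ `‖kerOpPin k (δ′η) (pinDist B₀∘posIn) (pinDist B₀∘posOut)‖ ≤ c₀·m·(2(d + (δ−δ′))∕(δ−δ′))^d` (S69 (A) with
`ρ := pl1`, rates `δη`, `δ′η`; the two spellings' weights agree: `pinW_eta_eq`). [folklore] -/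
theorem opNorm_kerOpPin_fineRate_le (k : Λ' → Λ → (𝔄 →L[ℂ] 𝔅)) (posIn : Λ → TPt d T) (posOut : Λ' → TPt d T)
    (B₀ : Finset (TPt d T)) (hB₀ : B₀.Nonempty) {m : ℕ}
    (hm : ∀ x, (Finset.univ.filter fun b => posIn b = x).card ≤ m) (hd : 0 < d)
    {c₀ δ δ' η : ℝ} (hc₀ : 0 ≤ c₀) (hδ' : 0 ≤ δ') (hδ : δ' < δ) (hη : 0 < η) (hη1 : η ≤ 1)
    (hk : ∀ c b, ‖k c b‖ ≤ c₀ * η ^ d * Real.exp (-((δ * η) * pl1 (posOut c - posIn b)))) :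
    ‖kerOpPin k (δ' * η) (pinDist B₀ hB₀ ∘ posIn) (pinDist B₀ hB₀ ∘ posOut)‖ ≤
      c₀ * (m * (2 * (d + (δ - δ')) / (δ - δ')) ^ d) := by
  have hrate : 0 < δ - δ' := by linarith
  have hM : ∀ x : TPt d T, ∑ b, Real.exp (-((δ * η - δ' * η) * pl1 (x - posIn b))) ≤ m * K₁ d ((δ - δ') * η) :=
    fun x => by
      have h := sum_exp_pl1_comp_le posIn hm (mul_pos hrate hη) x
      simpa only [sub_mul] using h
  have hM0 : 0 ≤ (m : ℝ) * K₁ d ((δ - δ') * η) := mul_nonneg (Nat.cast_nonneg m) (K₁_nonneg _ _)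
  have hop := opNorm_kerOpPin_le k (fun x y => pl1 (x - y)) posIn posOut (pinDist B₀ hB₀)
    (c₀ := c₀ * η ^ d) (δ := δ * η) (δ' := δ' * η) (by positivity) (by positivity) hM0 (fun c b => hk c b)
    (fun x y => pinDist_le_add B₀ hB₀ x y) hM
  refine hop.trans ?_
  calc c₀ * η ^ d * (m * K₁ d ((δ - δ') * η)) = c₀ * (m * (η ^ d * K₁ d ((δ - δ') * η))) := by ring
    _ ≤ c₀ * (m * (2 * (d + (δ - δ')) / (δ - δ')) ^ d) :=
        mul_le_mul_of_nonneg_left (mul_le_mul_of_nonneg_left (eta_pow_mul_K₁_le hd hrate hη hη1)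
          (Nat.cast_nonneg m)) hc₀

omit [NeZero T] in
/-- The two spellings of the pin weight agree: `pinW δ′ (η·pinDist ∘ pos) = pinW (δ′η) (pinDist ∘ pos)`. [folklore] -/
theorem pinW_eta_eq [NeZero T] {ι : Type*} (B₀ : Finset (TPt d T)) (hB₀ : B₀.Nonempty) (pos : ι → TPt d T)
    (δ' η : ℝ) :
    pinW δ' ((fun x => η * pinDist B₀ hB₀ x) ∘ pos) = pinW (δ' * η) (pinDist B₀ hB₀ ∘ pos) := by
  funext b
  simp only [pinW, Function.comp_apply]
  ring_nf

end Kernel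

/-! ## §3 (C-η): located sums over fine indices with the cell volume are η-free for an η-free reference set -/

section Sums

variable {d T : ℕ} [NeZero T]

/-- **(C-η) LOCATED SUMS OVER FINE INDICES, η-FREE.**  Indices placed on the fine torus by `pos : P → (ℤ∕Tℤ)^d` with at
most `m` per fine site, ANY nonempty finite reference set `B₀`, `δ′ > 0`, `0 < η ≤ 1`, `d ≥ 1`:
`Σ_p η^d·e^{−δ′·η·pinDist B₀ (pos p)} ≤ #B₀·m·(2(d + δ′)∕δ′)^d` (S69 `sum_exp_neg_pinDist_le` at the fine rate `δ′η`, then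
§1).  η-free exactly when `#B₀` is: take `B₀ :=` the block's UNIT-lattice sites (a block-geometry count, like END-II's
`m₀`), NOT its fine sites (`∝ η^{−d}`, §4). [folklore] -/
theorem sum_eta_exp_neg_pinDist_le {P : Type*} [Fintype P] (pos : P → TPt d T) {m : ℕ}
    (hm : ∀ x, (Finset.univ.filter fun p => pos p = x).card ≤ m) (B₀ : Finset (TPt d T)) (hB₀ : B₀.Nonempty)
    (hd : 0 < d) {δ' η : ℝ} (hδ' : 0 < δ') (hη : 0 < η) (hη1 : η ≤ 1) :
    ∑ p, η ^ d * Real.exp (-(δ' * (η * pinDist B₀ hB₀ (pos p)))) ≤ B₀.card * (m * (2 * (d + δ') / δ') ^ d) := by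
  have hs : ∑ p, Real.exp (-(δ' * (η * pinDist B₀ hB₀ (pos p)))) ≤ B₀.card * (m * K₁ d (δ' * η)) := by
    have h := sum_exp_neg_pinDist_le pos hm B₀ hB₀ (mul_pos hδ' hη)
    simpa only [mul_assoc] using h
  rw [← Finset.mul_sum]
  calc η ^ d * ∑ p, Real.exp (-(δ' * (η * pinDist B₀ hB₀ (pos p))))
      ≤ η ^ d * (B₀.card * (m * K₁ d (δ' * η))) := mul_le_mul_of_nonneg_left hs (by positivity)
    _ = B₀.card * (m * (η ^ d * K₁ d (δ' * η))) := by ring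
    _ ≤ B₀.card * (m * (2 * (d + δ') / δ') ^ d) :=
        mul_le_mul_of_nonneg_left (mul_le_mul_of_nonneg_left (eta_pow_mul_K₁_le hd hδ' hη hη1)
          (Nat.cast_nonneg m)) (Nat.cast_nonneg _)

/-- **(C-η), FINE-RATE SPELLING**: `Σ_p η^d·e^{−(δ′η)·pinDist B₀ (pos p)} ≤ #B₀·m·(2(d + δ′)∕δ′)^d`. [folklore] -/
theorem sum_eta_exp_neg_pinDist_fineRate_le {P : Type*} [Fintype P] (pos : P → TPt d T) {m : ℕ}
    (hm : ∀ x, (Finset.univ.filter fun p => pos p = x).card ≤ m) (B₀ : Finset (TPt d T)) (hB₀ : B₀.Nonempty)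
    (hd : 0 < d) {δ' η : ℝ} (hδ' : 0 < δ') (hη : 0 < η) (hη1 : η ≤ 1) :
    ∑ p, η ^ d * Real.exp (-((δ' * η) * pinDist B₀ hB₀ (pos p))) ≤ B₀.card * (m * (2 * (d + δ') / δ') ^ d) := by
  have h := sum_eta_exp_neg_pinDist_le pos hm B₀ hB₀ hd hδ' hη hη1
  simpa only [mul_assoc] using h

/-- **THE η-FREE BUDGET**: per-index costs carrying the cell volume and the physical pin,
`L p ≤ ℓ₀·η^d·e^{−δ′·η·pinDist B₀ (pos p)}` (`ℓ₀ ≥ 0`), against sizes `0 ≤ g p ≤ ḡ` ⟹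
`Σ_p L p·g p ≤ ℓ₀·ḡ·(#B₀·m·(2(d + δ′)∕δ′)^d)` — the η-free inhabitant of the located-sum binder `Σ_p e_p ≤ K` of S69 §5 ∕
S71 §3b ∕ S74 f2 `hsum_of_located` once the per-index `η^d` is carried by the costs (for the square terms it is:
`|β|H_pO_p ∝ βη⁴`, S72 `squareBudget_le`). [folklore] -/
theorem sum_mul_le_of_pinned_eta {P : Type*} [Fintype P] (pos : P → TPt d T) {m : ℕ}
    (hm : ∀ x, (Finset.univ.filter fun p => pos p = x).card ≤ m) (B₀ : Finset (TPt d T)) (hB₀ : B₀.Nonempty)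
    (hd : 0 < d) {δ' η : ℝ} (hδ' : 0 < δ') (hη : 0 < η) (hη1 : η ≤ 1) (L g : P → ℝ) {ℓ₀ gbar : ℝ}
    (hℓ₀ : 0 ≤ ℓ₀) (hgbar : 0 ≤ gbar)
    (hL : ∀ p, L p ≤ ℓ₀ * (η ^ d * Real.exp (-(δ' * (η * pinDist B₀ hB₀ (pos p))))))
    (hg0 : ∀ p, 0 ≤ g p) (hg : ∀ p, g p ≤ gbar) :
    ∑ p, L p * g p ≤ ℓ₀ * gbar * (B₀.card * (m * (2 * (d + δ') / δ') ^ d)) := by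
  calc ∑ p, L p * g p ≤ ∑ p, ℓ₀ * (η ^ d * Real.exp (-(δ' * (η * pinDist B₀ hB₀ (pos p))))) * gbar :=
        Finset.sum_le_sum fun p _ => mul_le_mul (hL p) (hg p) (hg0 p) (by positivity)
    _ = ℓ₀ * gbar * ∑ p, η ^ d * Real.exp (-(δ' * (η * pinDist B₀ hB₀ (pos p)))) := by
        rw [Finset.mul_sum]; exact Finset.sum_congr rfl fun p _ => by ring
    _ ≤ ℓ₀ * gbar * (B₀.card * (m * (2 * (d + δ') / δ') ^ d)) :=
        mul_le_mul_of_nonneg_left (sum_eta_exp_neg_pinDist_le pos hm B₀ hB₀ hd hδ' hη hη1) (by positivity)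

end Sums

/-! ## §4 The disease, witnessed: a FINE reference set makes the traded double sum `∝ η^{−d}` -/

section Disease

variable {d : ℕ}

/-- On `(ℤ∕Nℤ)^d` every periodic ℓ¹ length is at most `d·N∕2` (`|valMinAbs| ≤ N∕2` coordinatewise). [folklore] -/
theorem pl1_le_half {N : ℕ} [NeZero N] (x : TPt d N) : pl1 x ≤ d * N / 2 := by
  rw [pl1_eq_sum]
  have h : ∀ i, (pabs (x i) : ℝ) ≤ N / 2 := fun i => by
    have h1 : ((x i).valMinAbs.natAbs : ℝ) ≤ ((N / 2 : ℕ) : ℝ) := by exact_mod_cast ZMod.natAbs_valMinAbs_le (x i)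
    have h2 : ((N / 2 : ℕ) : ℝ) ≤ N / 2 := Nat.cast_div_le
    have h3 : (pabs (x i) : ℝ) = ((x i).valMinAbs.natAbs : ℝ) := by
      rw [pabs_eq_natAbs, Int.cast_natCast]
    rw [h3]; exact h1.trans h2
  calc ∑ i, (pabs (x i) : ℝ) ≤ ∑ _i : Fin d, (N : ℝ) / 2 := Finset.sum_le_sum fun i _ => h i
    _ = d * N / 2 := by rw [Finset.sum_const, Finset.card_univ, Fintype.card_fin, nsmul_eq_mul]; ring

/-- **THE NAIVE READING IS `∝ η^{−d}`.**  Take the reference set to be ALL fine sites — here the whole fine torus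
`(ℤ∕Nℤ)^d`, `η = 1∕N` — and the rate `a ≥ 0` per PHYSICAL unit.  The double sum that S69's `exp_neg_pinDist_le_sum` trades
the pin for («`e^{−δ′·min_{x₀∈B₀}ρ} ≤ Σ_{x₀∈B₀} e^{−δ′ρ}`»), weighted by the cell volume, obeys
`(1∕N)^d · Σ_{x₀} Σ_x e^{−a·(1∕N)·pl1(x − x₀)} ≥ N^d · e^{−ad∕2}` — UNBOUNDED in `N = η^{−1}` (each summand is
`≥ e^{−ad∕2}` by `pl1_le_half`, and there are `N^{2d}` of them): the step costs exactly `#B₀`, so in §3 `B₀` must be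
η-free-sized.  A statement about OUR bound under a naive instantiation — no filed module instantiates `B₀` this way.
[folklore] -/
theorem naive_doubleSum_ge (N : ℕ) [NeZero N] {a : ℝ} (ha : 0 ≤ a) :
    (N : ℝ) ^ d * Real.exp (-(a * d / 2)) ≤
      (1 / (N : ℝ)) ^ d * ∑ x₀ : TPt d N, ∑ x : TPt d N, Real.exp (-(a * ((1 / (N : ℝ)) * pl1 (x - x₀)))) := by
  have hN : (0 : ℝ) < N := by exact_mod_cast Nat.pos_of_ne_zero (NeZero.ne N)
  have hcard : (Fintype.card (TPt d N) : ℝ) = (N : ℝ) ^ d := by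
    rw [Fintype.card_pi, Finset.prod_const, Finset.card_univ, Fintype.card_fin, ZMod.card]; push_cast; rfl
  -- every summand is at least `e^{−ad∕2}`
  have hterm : ∀ x₀ x : TPt d N, Real.exp (-(a * d / 2)) ≤ Real.exp (-(a * ((1 / (N : ℝ)) * pl1 (x - x₀)))) := by
    intro x₀ x
    refine Real.exp_le_exp.2 (neg_le_neg ?_)
    have h1 : (1 / (N : ℝ)) * pl1 (x - x₀) ≤ d / 2 := by
      rw [one_div, inv_mul_le_iff₀ hN]
      have := pl1_le_half (x - x₀)
      linarith
    calc a * ((1 / (N : ℝ)) * pl1 (x - x₀)) ≤ a * (d / 2) := mul_le_mul_of_nonneg_left h1 ha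
      _ = a * d / 2 := by ring
  have hsum : (N : ℝ) ^ d * ((N : ℝ) ^ d * Real.exp (-(a * d / 2))) ≤
      ∑ x₀ : TPt d N, ∑ x : TPt d N, Real.exp (-(a * ((1 / (N : ℝ)) * pl1 (x - x₀)))) := by
    calc (N : ℝ) ^ d * ((N : ℝ) ^ d * Real.exp (-(a * d / 2)))
        = ∑ _x₀ : TPt d N, ∑ _x : TPt d N, Real.exp (-(a * d / 2)) := by
          rw [Finset.sum_const, Finset.sum_const, Finset.card_univ, nsmul_eq_mul, nsmul_eq_mul, hcard]
      _ ≤ ∑ x₀ : TPt d N, ∑ x : TPt d N, Real.exp (-(a * ((1 / (N : ℝ)) * pl1 (x - x₀)))) :=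
          Finset.sum_le_sum fun x₀ _ => Finset.sum_le_sum fun x _ => hterm x₀ x
  have hNd : 0 < (N : ℝ) ^ d := by positivity
  calc (N : ℝ) ^ d * Real.exp (-(a * d / 2))
      = (1 / (N : ℝ)) ^ d * ((N : ℝ) ^ d * ((N : ℝ) ^ d * Real.exp (-(a * d / 2)))) := by
        rw [one_div, inv_pow, ← mul_assoc, inv_mul_cancel₀ hNd.ne', one_mul]
    _ ≤ (1 / (N : ℝ)) ^ d * ∑ x₀ : TPt d N, ∑ x : TPt d N, Real.exp (-(a * ((1 / (N : ℝ)) * pl1 (x - x₀)))) :=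
        mul_le_mul_of_nonneg_left hsum (by positivity)

end Disease

end Summit.QuantumFields.BalabanUV.T4Continuum.ShellMeasurePinnedNormEta

end
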